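import Summits.RiemannHypothesis.RiemannHypothesis.Theorems.WeilColumnTruncatedWitness
import Summits.RiemannHypothesis.RiemannHypothesis.Theorems.WeilColumnTruncationError
import Summits.RiemannHypothesis.RiemannHypothesis.Theorems.WeilColumnThetaWitnessZeros
import Summits.RiemannHypothesis.RiemannHypothesis.Theorems.WeilColumnOddMollifier
import Summits.RiemannHypothesis.RiemannHypothesis.Theorems.WeilColumnThetaCutWitness
import Literature.NumberTheory.LFunctions.WeilMellinBounds
import Literature.NumberTheory.LFunctions.WeilZeroSum
import HarnessLib

/-!
(Authored by seat cc-s2-3 gen22 (p431958); re-filed by weil-1 gen19 with two gate fixes: the duplicate smoothTransition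
bound removed, the constant `W_R` inlined instead of a `def`.)

# PR Step 2: the mollified truncated odd profile `G_R⁻ ⋆ moll_k` is EXPONENTIALLY SMALL AT THE ZEROS (RH-FREE)

WEIL column (LADDER-RH, W-P(P2); tier-1 `ThetaCertificateSound`, THETA-ASSIGN v1.1 §6 Step 2; this seat's kept PR item, director
I 07:10:05Z split). For an admissible row `P`, `R ≥ a`, every `k`, and every nontrivial zero `ρ`:

  **`‖weilMellin (weilConv (P.GROdd R) (moll k)) ρ‖ ≤ e^{1/2}·(2·W_R)/‖ρ − ½‖`**,  `W_R = C·e^{−(m−1)R}/(m−1)`,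

where `C = (3/2 + Lψ)·M/u₁^m + M₁/u₁^{m−1}` and `Lψ` bounds `|smoothTransition′|` (any bound; e.g. weil-1's `exists_abs_deriv_smoothTransition_le`). Chain:
`(G_R⁻⋆moll_k)^ = (G_R⁻)^·m̂oll_k` (`weilMellin_weilConv_moll`), `‖m̂oll_k(ρ)‖ ≤ e^{1/2}` (`norm_weilMellin_moll_le`);
`(G_R⁻)^(ρ) = Ĝ_R(ρ) − Ĝ_R(1−ρ)` (`weilMellin_oddPart`); `Ĝ_R(s) = Ĝ₀(s) − Ê_R(s)` with `Ĝ₀(s) = mellin Θ s = 0` at `s = ρ, 1−ρ`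
((Z1), `WeilColumnThetaWitnessZeros` / `WeilColumnThetaMellin`); `‖Ê_R(s)‖ ≤ W_R/‖s−½‖` (`norm_weilMellin_truncError_le`, p424021,
with handoff-prove-2's tail envelopes). D2 enters as the lane-shape HYPOTHESES `hΘ'`, `hM₁`, `hΘ'c` (= `WeilColumnThetaMajorantD2`'s
`hasDerivAt_deriv_Θ`, `D2_on_Ioc`, `continuousOn_deriv_Θ` with `Θ' := deriv P.Θ`). RH-free; nothing here bears on the truth of RH.
-/

set_option linter.dupNamespace false

noncomputable section

open MeasureTheory Set Complex Filter
open scoped Real Topology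
open Literature.NumberTheory.LFunctions Literature.NumberTheory.LFunctions.WeilContinuous

namespace Summit.RiemannHypothesis.RiemannHypothesis.Theorems.WeilColumn.ThetaMellin

/-! ## The smooth step -/

/-- The smooth step `ψ_R(x) = smoothTransition(x + R + 1)` has derivative `smoothTransition′(x + R + 1)` (local copy; the named one is
weil-1's `hasDerivAt_smoothStep` in `WeilColumnThetaPRStep3ZeroDecay`). [folklore] -/
private theorem hasDerivAt_smoothStep_aux (R x : ℝ) :
    HasDerivAt (smoothStep R) (deriv Real.smoothTransition (x + R + 1)) x := by
  have hd : HasDerivAt Real.smoothTransition (deriv Real.smoothTransition (x + (R + 1))) (x + (R + 1)) :=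
    ((Real.smoothTransition.contDiff (n := 1)).differentiable (by norm_num) _).hasDerivAt
  have h2 : HasDerivAt (fun z : ℝ => Real.smoothTransition (z + (R + 1))) (deriv Real.smoothTransition (x + (R + 1))) x :=
    HasDerivAt.comp_add_const x (R + 1) hd
  have e : smoothStep R = fun z : ℝ => Real.smoothTransition (z + (R + 1)) := by
    funext z; simp only [smoothStep, add_assoc]
  rw [e, show x + R + 1 = x + (R + 1) by ring]
  exact h2

/-- `weilMellin` is subtractive when both integrands are integrable (no support assumption). [folklore] -/
theorem weilMellin_sub_of_integrable {f g : ℝ → ℂ} {s : ℂ} (hf : Integrable fun t : ℝ => f t * cexp ((s - 1 / 2) * t))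
    (hg : Integrable fun t : ℝ => g t * cexp ((s - 1 / 2) * t)) :
    weilMellin (fun t => f t - g t) s = weilMellin f s - weilMellin g s := by
  unfold weilMellin
  rw [← integral_sub hf hg]
  refine integral_congr_ae (Eventually.of_forall fun t => ?_)
  ring

namespace ThetaParams

variable (P : ThetaParams)

/-- Local `ProfileHyp` for the witness (the named one is `WeilColumnThetaWitnessBasics.profileHyp_G`). -/
private theorem profileHyp_G_step2 {qn : ℕ} (hP : P.Admissible qn) : ProfileHyp P.G (P.lam * P.c₁) (P.lam * P.c₂) := by
  have hm : 1 ≤ P.m := le_trans (by norm_num) hP.three_le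
  have hε : 0 ≤ P.ε := by have := hP.delta_pos; have := hP.c₂_pos; unfold ε; positivity
  have hlam : 0 < P.lam := by have := hP.c₂_pos; unfold lam; positivity
  have hle : P.c₁ ≤ P.c₂ := by linarith [hP.seed₁, hP.seed₂]
  refine ⟨(P.continuous_h hP).comp (continuous_id.div_const _), mul_pos hlam hP.c₁_pos,
    mul_le_mul_of_nonneg_left hle hlam.le, fun t ht => ?_⟩
  refine Function.notMem_support.mp fun hmem => ht ?_
  have hsub := support_profile_subset (α := P.α) hm hε hP.seed₂.le hP.seed₁.le hmem
  exact ⟨by have := (le_div_iff₀ hlam).mp hsub.1; linarith, by have := (div_le_iff₀ hlam).mp hsub.2; linarith⟩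

/-- `G_R` is continuous with compact support in `[−R−1, a]`; so is `G_R⁻`. [folklore] -/
theorem continuous_hasCompactSupport_GR {qn : ℕ} (hP : P.Admissible qn) (R : ℝ) :
    Continuous (P.GR R) ∧ HasCompactSupport (P.GR R) ∧ Continuous (P.GROdd R) ∧ HasCompactSupport (P.GROdd R) := by
  have hG₀ := continuous_G₀ hP
  have hc : Continuous (P.GR R) := by
    show Continuous fun x => P.G₀ x * (smoothStep R x : ℂ)
    exact hG₀.mul (Complex.continuous_ofReal.comp (continuous_smoothStep R))
  have hzero : ∀ x, x ∉ Icc (-R - 1) P.a → P.GR R x = 0 := by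
    intro x hx
    rw [mem_Icc, not_and_or, not_le, not_le] at hx
    rcases hx with hx | hx
    · exact P.GR_eq_zero_of_le hx.le
    · exact P.GR_eq_zero_of_lt hP hx
  have hs : HasCompactSupport (P.GR R) :=
    HasCompactSupport.of_support_subset_isCompact isCompact_Icc fun x hx => by
      by_contra h; exact hx (hzero x h)
  have hco : Continuous (P.GROdd R) := by
    show Continuous fun x => P.GR R x - P.GR R (-x)
    exact hc.sub (hc.comp continuous_neg)
  set B : ℝ := max (R + 1) |P.a| with hB
  have hso : HasCompactSupport (P.GROdd R) := by
    refine HasCompactSupport.of_support_subset_isCompact (isCompact_Icc (a := -B) (b := B)) fun x hx => ?_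
    by_contra h
    rw [mem_Icc, not_and_or, not_le, not_le] at h
    have h1 : P.GR R x = 0 := by
      rcases h with h | h
      · exact P.GR_eq_zero_of_le (by have := le_max_left (R + 1) |P.a|; linarith)
      · exact P.GR_eq_zero_of_lt hP (by have := le_max_right (R + 1) |P.a|; have := le_abs_self P.a; linarith)
    have h2 : P.GR R (-x) = 0 := by
      rcases h with h | h
      · exact P.GR_eq_zero_of_lt hP (by have := le_max_right (R + 1) |P.a|; have := le_abs_self P.a; linarith)
      · exact P.GR_eq_zero_of_le (by have := le_max_left (R + 1) |P.a|; linarith)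
    exact hx (by show P.GR R x - P.GR R (-x) = 0; rw [h1, h2, sub_zero])
  exact ⟨hc, hs, hco, hso⟩

/-- **PR STEP 2 — `G_R⁻ ⋆ moll_k` AT THE ZEROS.** With D2 in the lane's hypothesis shape (`Θ' := deriv P.Θ` from
`WeilColumnThetaMajorantD2`), a bound `Lψ` on `|smoothTransition′|`, `R ≥ a`, any `k`, and any nontrivial zero `ρ`:
`‖(G_R⁻ ⋆ moll_k)^(ρ)‖ ≤ e^{1/2}·(2·W_R)/‖ρ − ½‖`. [this seat, PR Step 2] -/
theorem norm_weilMellin_GROdd_moll_le {qn : ℕ} (hP : P.Admissible qn) {Θ' : ℝ → ℂ}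
    (hΘ' : ∀ u : ℝ, 0 < u → HasDerivAt P.Θ (Θ' u) u) (hΘ'c : ContinuousOn Θ' (Ioi 0))
    (hM₁ : ∀ u ∈ Ioc (0 : ℝ) P.u₁, ‖(u : ℂ) * Θ' u‖ ≤ P.M₁ * (u / P.u₁) ^ (P.m - 1))
    {Lψ : ℝ} (hLψ0 : 0 ≤ Lψ) (hLψ : ∀ y : ℝ, |deriv Real.smoothTransition y| ≤ Lψ)
    {R : ℝ} (hR : P.a ≤ R) (k : ℕ) {ρ : ℂ} (hρ : ρ ∈ RHWave0.riemannZetaNontrivialZeros) :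
    ‖weilMellin (weilConv (P.GROdd R) (moll k)) ρ‖ ≤ Real.exp (1 / 2) * (2 * (((((3 / 2 + Lψ) * P.M) / P.u₁ ^ P.m + P.M₁ / P.u₁ ^ (P.m - 1)) * Real.exp ((((P.m : ℝ) - 1 / 2) - 1 / 2) * (-R)) / (((P.m : ℝ) - 1 / 2) - 1 / 2)))) / ‖ρ - 1 / 2‖ := by
  -- parameters
  have hm2 : 2 ≤ P.m := le_trans (by norm_num) hP.three_le
  have hm : 1 ≤ P.m := le_trans (by norm_num) hm2
  have hε : 0 < P.ε := by have := hP.delta_pos; have := hP.c₂_pos; unfold ε; positivity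
  have hlam : 0 < P.lam := by have := hP.c₂_pos; unfold lam; positivity
  have hu₁ : P.u₁ = Real.exp P.x₁ := rfl
  have hx₁ : P.x₁ < 0 := P.x₁_neg hP
  have ha : 0 < P.a := by
    have : 0 ≤ Real.log (P.q : ℝ) := Real.log_natCast_nonneg _
    have := hP.delta_pos; unfold a; linarith
  have hR0 : 0 ≤ R := by linarith
  have hRx : -R ≤ P.x₁ := by have := hP.eta_pos; unfold x₁; linarith
  have hα : 0 ≤ P.α := div_nonneg (by linarith [hP.seed₂]) (by linarith [hP.seed₁])
  have hu₁pos : 0 < P.u₁ := Real.exp_pos _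
  have hM0 : 0 ≤ P.M := by
    have h1 := P.norm_Θ_le' hP hu₁pos
    rw [div_self hu₁pos.ne', one_pow, mul_one] at h1
    exact (norm_nonneg _).trans h1
  have hM₁0 : 0 ≤ P.M₁ := by
    have hcs : 0 ≤ P.csum := by unfold csum; linarith
    have hzs : 0 < P.zstar := by unfold zstar; positivity
    have hc₂ := hP.c₂_pos
    have hzt : 0 ≤ zetaTail P.m := tsum_nonneg fun n => by positivity
    unfold M₁; positivity
  -- zero facts
  have hζ := ZetaZeros.riemannZetaNontrivialZeros.zeta_eq_zero hρ
  have h0 := ZetaZeros.riemannZetaNontrivialZeros.re_pos hρ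
  have h1 := ZetaZeros.riemannZetaNontrivialZeros.re_lt_one hρ
  have him := ZetaZeros.riemannZetaNontrivialZeros.im_ne_zero hρ
  have hρhalf : ρ ≠ 1 / 2 := by
    intro h; apply him; rw [h]; norm_num
  have hρhalf' : (1 - ρ) ≠ 1 / 2 := by
    intro h; apply him
    have := congrArg Complex.im h
    simp at this; linarith
  have h0' : 0 ≤ (1 - ρ).re := by simp; linarith
  have hnorm' : ‖(1 - ρ) - 1 / 2‖ = ‖ρ - 1 / 2‖ := by
    rw [show (1 - ρ) - 1 / 2 = -(ρ - 1 / 2) by ring, norm_neg]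
  have hw : 0 < ‖ρ - 1 / 2‖ := norm_pos_iff.mpr (sub_ne_zero.mpr hρhalf)
  -- the smooth step as the cut of `WeilColumnTruncationError`
  have hψ01 : ∀ x, smoothStep R x ∈ Icc (0 : ℝ) 1 := smoothStep_mem_Icc R
  have hψ1 : ∀ x, -R ≤ x → smoothStep R x = 1 := fun x hx => smoothStep_eq_one hx
  have hψ' : ∀ x, HasDerivAt (smoothStep R) (deriv Real.smoothTransition (x + R + 1)) x := hasDerivAt_smoothStep_aux R
  have hψ'c : Continuous fun x => deriv Real.smoothTransition (x + R + 1) :=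
    (Real.smoothTransition.contDiff (n := 1)).continuous_deriv_one.comp (by fun_prop)
  have hLψ' : ∀ x, |deriv Real.smoothTransition (x + R + 1)| ≤ Lψ := fun x => hLψ _
  -- Ê_R bound at s = ρ and s = 1 − ρ
  have hE : ∀ s : ℂ, 0 ≤ s.re → s ≠ 1 / 2 → ‖weilMellin (P.ER R) s‖ ≤ (((((3 / 2 + Lψ) * P.M) / P.u₁ ^ P.m + P.M₁ / P.u₁ ^ (P.m - 1)) * Real.exp ((((P.m : ℝ) - 1 / 2) - 1 / 2) * (-R)) / (((P.m : ℝ) - 1 / 2) - 1 / 2))) / ‖s - 1 / 2‖ := by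
    intro s hs0 hs
    have := norm_weilMellin_truncError_le (Θ := P.Θ) (ψ := smoothStep R) hm2 hu₁ hR0 hRx hx₁.le hΘ' hΘ'c
      (fun u hu => P.norm_Θ_le' hP hu.1) hM₁ hM0 hM₁0 hψ01 hψ1 hψ' hψ'c hLψ' hLψ0 hs0 hs
    exact this
  -- integrability of the Mellin integrands of G₀ and G_R at ρ and 1 − ρ
  obtain ⟨hGRc, hGRs, hGOc, hGOs⟩ := P.continuous_hasCompactSupport_GR hP R
  have hIG₀ : ∀ s : ℂ, 0 < s.re → Integrable fun t : ℝ => P.G₀ t * cexp ((s - 1 / 2) * t) := fun s hs =>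
    (integrable_expProfile_iff P.Θ s).mpr (P.mellinConvergent_Θ hP hs)
  have hIGR : ∀ s : ℂ, Integrable fun t : ℝ => P.GR R t * cexp ((s - 1 / 2) * t) := fun s =>
    integrable_weilIntegrand hGRc hGRs s
  -- Ĝ_R(s) = Ĝ₀(s) − Ê_R(s) = −Ê_R(s) at the zeros
  have hGR : ∀ s : ℂ, 0 < s.re → weilMellin (P.GR R) s = weilMellin P.G₀ s - weilMellin (P.ER R) s := by
    intro s hs
    have e : P.ER R = fun t => P.G₀ t - P.GR R t := by
      funext t; rw [P.G₀_eq_GR_add_ER R t]; ring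
    have hIE : Integrable fun t : ℝ => P.ER R t * cexp ((s - 1 / 2) * t) := by
      rw [e]; exact ((hIG₀ s hs).sub (hIGR s)).congr (Eventually.of_forall fun t => by simp only [Pi.sub_apply]; ring)
    have := weilMellin_sub_of_integrable (hIG₀ s hs) hIE
    have e2 : (fun t => P.G₀ t - P.ER R t) = P.GR R := by funext t; rw [P.G₀_eq_GR_add_ER R t]; ring
    rw [e2] at this
    rw [this]
  have hG₀ρ : weilMellin P.G₀ ρ = 0 := by
    show weilMellin (expProfile P.Θ) ρ = 0
    rw [weilMellin_expProfile]
    exact (P.profileHyp_G_step2 hP).mellin_thetaSum_eq_zero_of_zeta_zero (P.thetaBoundedNearZero hP) hζ h0 h1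
  have hG₀ρ' : weilMellin P.G₀ (1 - ρ) = 0 := by
    show weilMellin (expProfile P.Θ) (1 - ρ) = 0
    rw [weilMellin_expProfile]
    have hζ' : riemannZeta (1 - ρ) = 0 := Literature.NumberTheory.LFunctions.GeneralizedRH.riemannZeta_one_sub_eq_zero hζ h0 h1
    exact (P.profileHyp_G_step2 hP).mellin_thetaSum_eq_zero_of_zeta_zero (P.thetaBoundedNearZero hP) hζ'
      (by simp; linarith) (by simp; linarith)
  -- (G_R⁻)^(ρ) = Ĝ_R(ρ) − Ĝ_R(1−ρ) = Ê_R(1−ρ) − Ê_R(ρ)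
  have hodd : weilMellin (P.GROdd R) ρ = weilMellin (P.ER R) (1 - ρ) - weilMellin (P.ER R) ρ := by
    have e : P.GROdd R = fun x => P.GR R x - P.GR R (-x) := rfl
    rw [e, weilMellin_oddPart hGRc hGRs ρ, hGR ρ h0, hGR (1 - ρ) (by simp; linarith), hG₀ρ, hG₀ρ']
    ring
  -- assemble
  rw [weilMellin_weilConv_moll hGOc hGOs k ρ, norm_mul, hodd]
  have hmoll : ‖weilMellin (moll k) ρ‖ ≤ Real.exp (1 / 2) := by
    refine (norm_weilMellin_moll_le k ρ).trans (Real.exp_le_exp.mpr ?_)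
    rw [abs_le]; constructor <;> linarith
  have hE1 := hE ρ h0.le hρhalf
  have hE2 := hE (1 - ρ) h0' hρhalf'
  rw [hnorm'] at hE2
  have hWR0 : 0 ≤ (((((3 / 2 + Lψ) * P.M) / P.u₁ ^ P.m + P.M₁ / P.u₁ ^ (P.m - 1)) * Real.exp ((((P.m : ℝ) - 1 / 2) - 1 / 2) * (-R)) / (((P.m : ℝ) - 1 / 2) - 1 / 2))) := le_trans (by positivity) (le_trans hE1 (le_of_eq rfl)) |> fun _ => by
    have := (norm_nonneg _).trans hE1
    exact (div_nonneg_iff.mp this).elim (fun h => h.1) fun h => by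
      exfalso; exact absurd h.2 (not_le.mpr hw)
  calc ‖weilMellin (P.ER R) (1 - ρ) - weilMellin (P.ER R) ρ‖ * ‖weilMellin (moll k) ρ‖
      ≤ ((((((3 / 2 + Lψ) * P.M) / P.u₁ ^ P.m + P.M₁ / P.u₁ ^ (P.m - 1)) * Real.exp ((((P.m : ℝ) - 1 / 2) - 1 / 2) * (-R)) / (((P.m : ℝ) - 1 / 2) - 1 / 2))) / ‖ρ - 1 / 2‖ + (((((3 / 2 + Lψ) * P.M) / P.u₁ ^ P.m + P.M₁ / P.u₁ ^ (P.m - 1)) * Real.exp ((((P.m : ℝ) - 1 / 2) - 1 / 2) * (-R)) / (((P.m : ℝ) - 1 / 2) - 1 / 2))) / ‖ρ - 1 / 2‖) * Real.exp (1 / 2) :=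
        mul_le_mul ((norm_sub_le _ _).trans (add_le_add hE2 hE1)) hmoll (norm_nonneg _) (by positivity)
    _ = Real.exp (1 / 2) * (2 * (((((3 / 2 + Lψ) * P.M) / P.u₁ ^ P.m + P.M₁ / P.u₁ ^ (P.m - 1)) * Real.exp ((((P.m : ℝ) - 1 / 2) - 1 / 2) * (-R)) / (((P.m : ℝ) - 1 / 2) - 1 / 2)))) / ‖ρ - 1 / 2‖ := by field_simp; ring

end ThetaParams

end Summit.RiemannHypothesis.RiemannHypothesis.Theorems.WeilColumn.ThetaMellin
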